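import Literature.Algebra.Homology.DiscreteRepEnoughInjectives
import Literature.Algebra.Homology.DiscreteRepInvariants
import Literature.Algebra.Homology.ExtAdjunction
import Mathlib.RepresentationTheory.FiniteIndex
import Mathlib.Algebra.Homology.ShortComplex.ExactFunctor
import Mathlib.Topology.Algebra.OpenSubgroup
import HarnessLib

/-!
# Open subgroups: restriction `C_Γ ⥤ C_U`, coinduction `C_U ⥤ C_Γ`, the two adjunctions, and
# Shapiro's lemma for `Ext` in the category of discrete modules (Harari Remark 16.13, Prop. 1.39)

Topic `Algebra/Homology`; namespace `Literature.Algebra.Homology.DiscreteRep`.  Sequel of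
`DiscreteRepCategory` / `DiscreteRepEnoughInjectives` / `DiscreteRepInvariants` (the abelian category
`C_Γ = DiscreteRepCat k Γ`, its `Ext`, `triv`) and `ExtAdjunction` (Eckmann–Shapiro for `Ext` along
an adjunction with exact adjoints); no named fact, no `sorry`.

For an OPEN subgroup `U` of FINITE INDEX in a topological group `Γ` (e.g. any open subgroup of a
compact group, `Subgroup.quotient_finite_of_isOpen`), restricted to the full subcategories of
representations with open stabilisers, Mathlib's restriction and co-induction functors
`Rep.resFunctor U.subtype : Rep k Γ ⥤ Rep k U` and `Rep.coindFunctor k U.subtype : Rep k U ⥤ Rep k Γ`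
(`Coind(N) = {f : Γ → N | f (u x) = u f x}`, `(g f)(x) = f (x g)`) and Mathlib's two adjunctions
`Rep.resCoindAdjunction` (`Res ⊣ Coind`) and `Rep.coindResAdjunction` (`Coind ⊣ Res`, finite index,
through `Ind ≅ Coind`) give:

* `resD U : C_Γ ⥤ C_U` (stabilisers in `U` are traces of stabilisers in `Γ`) and, for `U` open of
  finite index, `coindD U hU : C_U ⥤ C_Γ` (`isDiscrete_coind`: the stabiliser of `f` contains the
  finite intersection over right cosets `U rᵢ` of the open sets `{g | rᵢ g rᵢ⁻¹ ∈ stab_U(f rᵢ)}`);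
* the adjunctions `resCoindAdj : resD ⊣ coindD` and `coindResAdj : coindD ⊣ resD`
  (Mathlib's, restricted with `Adjunction.restrictFullyFaithful`), whence both functors are exact;
* **Shapiro's lemma for `Ext` in both variables** (Harari, *Galois Cohomology and Class Field
  Theory*, Remark 16.13 and Prop. 1.39; Serre I §2.5; Weibel Lemma 6.3.2), from `ExtAdjunction`:
  `extResCoindAddEquiv : Extⁿ_{C_U}(Res A, N) ≃+ Extⁿ_{C_Γ}(A, Coind N)`,
  `extCoindResAddEquiv : Extⁿ_{C_Γ}(Coind N, A) ≃+ Extⁿ_{C_U}(N, Res A)`, and with `A = k`: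
  **`shapiroAddEquiv : Hⁿ(Γ, Coind N) := Extⁿ_{C_Γ}(k, Coind N) ≃+ Extⁿ_{C_U}(k, N) =: Hⁿ(U, N)`**.

Written for Route A of the Poitou–Tate programme of crux `stmt-BirchSwinnertonDyer-19295` (cell
`bsd-schneider-ideate`, seat door-c4 gen 13): Shapiro for `Ext^r_G(·, C)` and `H^r(G, ·)` is the
dimension-shifting input of Tate's duality theorem for class formations (Harari Thm. 16.21).

## References
* D. Harari, *Galois Cohomology and Class Field Theory* (2020), §1.2 (Props. 1.12, 1.15), Prop. 1.39,
  §4.2, §4.3 (1)–(4), Remark 16.13. [Harari2020]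
* J.-P. Serre, *Galois Cohomology*, Springer (1997), I §2.5. [SerreGaloisCohomology1997]
* C. A. Weibel, *An introduction to homological algebra* (1994), Lemma 6.3.2. [Weibel1994]
-/

-- CITATION-FIX (2026-08-27, door-c4 g13; referee flags Q-g50-1/Q-g51-1, held copy
-- `book:harari2017-galois-cohomology-class-field-theory`): earlier revisions of this file cited
-- "Harari Prop. 16.17" for Shapiro-type isomorphisms of `Ext`.  Prop. 16.17 (p. 272) is the
-- compatibility of the cup-product with the `Ext` pairing; the printed homes are Remark 16.13
-- (p. 269: `Ext_G^i(A, I_G^H(B)) ≃ Ext_H^i(A, B)`), Proposition 1.39 (p. 48: first variable,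
-- `Ext_H^i(A, B) ≃ Ext_G^i(I_G^H(A), B)`, valid for `H` open by §4.3 (4), p. 97) and, for the
-- adjunctions, Propositions 1.12 / 1.15 (§1.2).  Citations below corrected; declarations unchanged.

noncomputable section

universe u

namespace Literature.Algebra.Homology

namespace DiscreteRep

open CategoryTheory CategoryTheory.Limits CategoryTheory.Abelian

variable {k Γ : Type u} [CommRing k] [Group Γ] [TopologicalSpace Γ] (U : Subgroup Γ)

/-! ## §1 Restriction to a subgroup -/

/-- The restriction to a subgroup of a discrete representation is discrete (the stabiliser in `U`
is the trace of the stabiliser in `Γ`). [cite: Harari2020, §4.2] -/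
theorem isDiscrete_res (A : DiscreteRepCat k Γ) :
    IsDiscrete ((Rep.resFunctor U.subtype).obj A.obj) := fun x => by
  have h : (stabilizer ((Rep.resFunctor U.subtype).obj A.obj) x : Set U) =
      ((↑) : U → Γ) ⁻¹' (stabilizer A.obj x : Set Γ) := by
    ext u
    rfl
  rw [h]
  exact (A.property x).preimage continuous_subtype_val

variable (k) in
/-- **Restriction `Res : C_Γ ⥤ C_U`** to a subgroup (Mathlib's `Rep.resFunctor U.subtype` on the
discrete objects). [cite: Harari2020, §4.2] -/
def resD : DiscreteRepCat k Γ ⥤ DiscreteRepCat k U :=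
  (isDiscrete k U).lift (ι k Γ ⋙ Rep.resFunctor U.subtype) fun A => isDiscrete_res U A

/-- `resD ⋙ ι = ι ⋙ Rep.resFunctor` (definitionally). [cite: Harari2020, §4.2] -/
def resDCompιIso : resD k U ⋙ ι k U ≅ ι k Γ ⋙ Rep.resFunctor U.subtype := Iso.refl _

/-- On objects. [cite: Harari2020, §4.2] -/
@[simp]
theorem resD_obj_obj (A : DiscreteRepCat k Γ) :
    ((resD k U).obj A).obj = (Rep.resFunctor U.subtype).obj A.obj := rfl

/-- On morphisms, elementwise (the underlying linear map is unchanged). [cite: Harari2020, §4.2] -/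
@[simp]
theorem resD_map_hom_apply {A B : DiscreteRepCat k Γ} (f : A ⟶ B) (x : A.obj.V) :
    ((resD k U).map f).hom.hom x = f.hom.hom x := rfl

/-- The trivial representation restricts to the trivial representation (definitionally).
[cite: Harari2020, §4.2] -/
theorem resD_triv (V : Type u) [AddCommGroup V] [Module k V] :
    (resD k U).obj (triv (Γ := Γ) V) = triv (Γ := U) V := rfl

/-- `Res` is additive. [cite: Harari2020, §4.2] -/
instance : (resD k U).Additive where
  map_add := rfl

variable [IsTopologicalGroup Γ]

/-- `Res` preserves monomorphisms (monomorphisms are the injective maps on both sides).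
[cite: Harari2020, §4.2] -/
instance : (resD k U).PreservesMonomorphisms where
  preserves f hf := by
    apply (ι k U).mono_of_mono_map
    rw [Rep.mono_iff_injective]
    exact (Rep.mono_iff_injective ((ι k Γ).map f)).1 inferInstance

/-! ## §2 Coinduction from an open subgroup of finite index -/

section Coind

variable (hU : IsOpen (U : Set Γ)) [U.FiniteIndex]

include hU in
/-- **The co-induced representation of a discrete `U`-module is discrete** when `U` is open of
finite index: the stabiliser of `f : Γ → N` (`f (u x) = u • f x`, action `(g • f) x = f (x g)`)
contains the finite intersection, over a system of right-coset representatives `rᵢ`, of the open sets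
`{g | rᵢ g rᵢ⁻¹ ∈ stab_U (f rᵢ)}`. [cite: Harari2020, §4.2 and §4.3 (1)] -/
theorem isDiscrete_coind (N : DiscreteRepCat k U) :
    IsDiscrete ((Rep.coindFunctor k U.subtype).obj N.obj) :=
    fun (f : Representation.coindV U.subtype N.obj.ρ) => by
  have hf : ∀ (u : U) (x : Γ), (f : Γ → N.obj.V) (u * x) = N.obj.ρ u ((f : Γ → N.obj.V) x) :=
    (Representation.mem_coindV _ _ _).1 f.2
  -- right cosets and representatives
  letI := QuotientGroup.rightRel U
  haveI : Finite (Quotient (QuotientGroup.rightRel U)) :=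
    Finite.of_equiv _ (QuotientGroup.quotientRightRelEquivQuotientLeftRel U).symm
  let r : Quotient (QuotientGroup.rightRel U) → Γ := fun q => q.out
  -- the open set `W q = {g | r q * g * (r q)⁻¹ ∈ stab_U (f (r q))}` (image in `Γ` of an open subset of `U`)
  let W : Quotient (QuotientGroup.rightRel U) → Set Γ := fun q =>
    (fun g => r q * g * (r q)⁻¹) ⁻¹'
      (((↑) : U → Γ) '' (stabilizer N.obj ((f : Γ → N.obj.V) (r q)) : Set U))
  have hW : ∀ q, IsOpen (W q) := fun q =>
    ((hU.isOpenEmbedding_subtypeVal.isOpenMap _ (N.property _)).preimage (by fun_prop))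
  have hW1 : ∀ q, (1 : Γ) ∈ W q := fun q =>
    ⟨1, (stabilizer N.obj _).one_mem, by simp [r]⟩
  apply Subgroup.isOpen_of_mem_nhds (g := 1)
  refine Filter.mem_of_superset ((isOpen_iInter_of_finite hW).mem_nhds (Set.mem_iInter.2 hW1))
    fun g hg => ?_
  rw [SetLike.mem_coe, mem_stabilizer_iff]
  -- `(g • f) x = f (x * g)`; write `x = u * r q`
  apply Subtype.ext
  funext x
  change (f : Γ → N.obj.V) (x * g) = (f : Γ → N.obj.V) x
  let q : Quotient (QuotientGroup.rightRel U) := Quotient.mk _ x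
  have hx : x * (r q)⁻¹ ∈ U := by
    have := Quotient.mk_out (s := QuotientGroup.rightRel U) x
    rw [QuotientGroup.rightRel_apply] at this
    simpa [r, q] using this
  obtain ⟨s, hs, hsg⟩ := Set.mem_iInter.1 hg q
  have hfs : (f : Γ → N.obj.V) (↑s * r q) = N.obj.ρ s ((f : Γ → N.obj.V) (r q)) := hf s (r q)
  rw [(mem_stabilizer_iff _ _ _).1 hs] at hfs
  have hux : (f : Γ → N.obj.V) x =
      N.obj.ρ ⟨x * (r q)⁻¹, hx⟩ ((f : Γ → N.obj.V) (r q)) := by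
    have := hf ⟨x * (r q)⁻¹, hx⟩ (r q)
    simpa using this
  have huxg : (f : Γ → N.obj.V) (x * g) =
      N.obj.ρ ⟨x * (r q)⁻¹, hx⟩ ((f : Γ → N.obj.V) (r q * g)) := by
    have := hf ⟨x * (r q)⁻¹, hx⟩ (r q * g)
    simpa [mul_assoc] using this
  have hrg : (f : Γ → N.obj.V) (r q * g) = (f : Γ → N.obj.V) (r q) := by
    have : r q * g = ↑s * r q := by
      rw [hsg]; group
    rw [this, hfs]
  rw [huxg, hrg, ← hux]

variable (k) in
/-- **Coinduction `Coind : C_U ⥤ C_Γ`** from an open subgroup of finite index (Mathlib's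
`Rep.coindFunctor k U.subtype` on the discrete objects). [cite: Harari2020, §4.3 (1)] -/
def coindD : DiscreteRepCat k U ⥤ DiscreteRepCat k Γ :=
  (isDiscrete k Γ).lift (ι k U ⋙ Rep.coindFunctor k U.subtype) fun N => isDiscrete_coind U hU N

/-- `coindD ⋙ ι = ι ⋙ Rep.coindFunctor` (definitionally). [cite: Harari2020, §4.3 (1)] -/
def coindDCompιIso : coindD k U hU ⋙ ι k Γ ≅ ι k U ⋙ Rep.coindFunctor k U.subtype := Iso.refl _

/-- On objects. [cite: Harari2020, §4.3 (1)] -/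
@[simp]
theorem coindD_obj_obj (N : DiscreteRepCat k U) :
    ((coindD k U hU).obj N).obj = (Rep.coindFunctor k U.subtype).obj N.obj := rfl

/-! ## §3 The two adjunctions and exactness -/

/-- **`Res ⊣ Coind`** on discrete objects (Mathlib's `Rep.resCoindAdjunction`, restricted to the full
subcategories). [cite: Harari2020, §1.2, Proposition 1.12] -/
def resCoindAdj : resD k U ⊣ coindD k U hU :=
  (Rep.resCoindAdjunction k U.subtype).restrictFullyFaithful (iC := ι k Γ) (iD := ι k U)
    (isDiscrete k Γ).fullyFaithfulι (isDiscrete k U).fullyFaithfulι (Iso.refl _) (Iso.refl _)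

/-- **`Coind ⊣ Res`** on discrete objects for `U` of finite index (Mathlib's
`Rep.coindResAdjunction`, through `Ind ≅ Coind`, restricted). [cite: Harari2020, §1.2, Proposition 1.15] -/
def coindResAdj : coindD k U hU ⊣ resD k U :=
  letI : DecidableRel (QuotientGroup.rightRel U) := Classical.decRel _
  (Rep.coindResAdjunction k U).restrictFullyFaithful (iC := ι k U) (iD := ι k Γ)
    (isDiscrete k U).fullyFaithfulι (isDiscrete k Γ).fullyFaithfulι (Iso.refl _) (Iso.refl _)

/-- `Coind` is a right adjoint. [cite: Harari2020, §1.2, Proposition 1.12] -/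
instance : (coindD k U hU).IsRightAdjoint := (resCoindAdj U hU).isRightAdjoint

/-- `Coind` is a left adjoint (finite index). [cite: Harari2020, §1.2, Proposition 1.15] -/
instance : (coindD k U hU).IsLeftAdjoint := (coindResAdj U hU).isLeftAdjoint

/-- `Coind` is additive. [cite: Harari2020, §4.3 (1)] -/
instance : (coindD k U hU).Additive := (resCoindAdj U hU).right_adjoint_additive

/-- `Coind` preserves monomorphisms. [cite: Harari2020, §4.3 (2)] -/
instance : (coindD k U hU).PreservesMonomorphisms := inferInstance

/-- `Coind` is exact: finite limits. [cite: Harari2020, §4.3 (2)] -/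
instance : PreservesFiniteLimits (coindD k U hU) := inferInstance

/-- `Coind` is exact: finite colimits (finite index). [cite: Harari2020, §4.3 (2)] -/
instance : PreservesFiniteColimits (coindD k U hU) := inferInstance

include hU in
/-- `Res` is exact: finite limits (it is right adjoint to `Coind`, finite index).
[cite: Harari2020, §4.2] -/
theorem preservesFiniteLimits_resD : PreservesFiniteLimits (resD k U) :=
  haveI : (resD k U).IsRightAdjoint := (coindResAdj U hU).isRightAdjoint
  inferInstance

include hU in
/-- `Res` is exact: finite colimits (it is left adjoint to `Coind`). [cite: Harari2020, §4.2] -/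
theorem preservesFiniteColimits_resD : PreservesFiniteColimits (resD k U) :=
  haveI : (resD k U).IsLeftAdjoint := (resCoindAdj U hU).isLeftAdjoint
  inferInstance

/-! ## §4 Shapiro's lemma for `Ext` -/

/-- **Shapiro (second variable): `Extⁿ_{C_U}(Res A, N) ≃+ Extⁿ_{C_Γ}(A, Coind N)`.**
[cite: Harari2020, Remark 16.13][cite: Weibel1994, Lemma 6.3.2] -/
def extResCoindAddEquiv (A : DiscreteRepCat k Γ) (N : DiscreteRepCat k U) (n : ℕ) :
    Ext ((resD k U).obj A) N n ≃+ Ext A ((coindD k U hU).obj N) n :=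
  ExtAdjunction.extAddEquiv (resCoindAdj U hU) A N n

/-- **Shapiro (first variable): `Extⁿ_{C_Γ}(Coind N, A) ≃+ Extⁿ_{C_U}(N, Res A)`** (finite index).
[cite: Harari2020, Proposition 1.39][cite: Weibel1994, Lemma 6.3.2] -/
def extCoindResAddEquiv (N : DiscreteRepCat k U) (A : DiscreteRepCat k Γ) (n : ℕ) :
    Ext ((coindD k U hU).obj N) A n ≃+ Ext N ((resD k U).obj A) n :=
  haveI := preservesFiniteLimits_resD (k := k) U hU
  haveI := preservesFiniteColimits_resD (k := k) U hU
  ExtAdjunction.extAddEquiv (coindResAdj U hU) N A n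

/-- **Shapiro's lemma: `Hⁿ(Γ, Coind N) ≃+ Hⁿ(U, N)`** with `Hⁿ(G, ·) = Extⁿ_{C_G}(k, ·)`.
[cite: Harari2020, Remark 16.13][cite: SerreGaloisCohomology1997, I §2.5] -/
def shapiroAddEquiv (N : DiscreteRepCat k U) (n : ℕ) :
    Ext (triv (k := k) (Γ := Γ) k) ((coindD k U hU).obj N) n ≃+ Ext (triv (k := k) (Γ := U) k) N n :=
  (extResCoindAddEquiv U hU (triv (k := k) (Γ := Γ) k) N n).symm

end Coind

end DiscreteRep

end Literature.Algebra.Homology
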